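import Summits.PneNP.PneNP.Theorems.ChebyshevTracialDesignTiltedSmallBlockAllDirections
import HarnessLib

/-!
# Cell pnp-psdrank, route `ChebyshevTracialDesign`: THE 𝒜₁ RUNG FOR ONE-BLOCK MASKS UP TO `|H| ≲ √(n·dq n)` (brick 156; crux
# `TracialDecayExp20`, stmt-PneNP-19878)

Brick 156 (prover g30; MEMO-33 §4). Brick 154's turnkey form reaches blocks of size `≤ √n/4` (no cut-off on the number of internal
matching edges). With brick 153's CUT-OFF headline `tilted_designValue_avg_le_cutoff_pow` at `a₁ = ⌊dq n/4⌋` (the matchings with more than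
`⌊dq n/2⌋−1` internal edges are charged to the `a`-tail climbed only from `a₁`, eng's T-K4b mechanism) the same 𝒜₁ rung holds for every
block with `100|H|(|H|+1) ≤ n·dq n` (`|H| ≲ n^{5/8}/10`), at the price of the decay `(1/9)^{⌊dq n/2⌋−⌊dq n/4⌋}` on the tail term:

* §1 `sqrtD_block_admissible` — for `⌊√n⌋ ≥ 12100` the choice `R = s₀ − (3(dq n+1) + |H| + (Tq n−1)/2 + 2)`, `a₁ = ⌊dq n/4⌋` satisfies every
  hypothesis of brick 153's cut-off headline (elementary real arithmetic: `(h/R)² ≤ 8·dq n/⌊√n⌋²`, `e^{3h/R} ≤ 3`).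
* §2 **`mediumBlock_amplitudeOne_value_le`**: ∃ `a > 0`, `n₀`: for all even `n ≥ n₀`, every balanced `B = 20` Chebyshev design, every `H`
  with `100|H|(|H|+1) ≤ n·dq n`, every `0 ≤ ψ ≤ G` on `[0,t]`, every degree-one Gram contraction `B` (`B_UB_Uᵀ ⪯ I` on `t`-cuts), every
  `0 ⪯ Y_M ⪯ I` of dimension `r`:
  `Σ_{U,M} W(U,M)ψ(|U∩H|)tr(B_UB_UᵀY_M) ≤ 8(20G((5t+5Tq n+4)²(1/3)^{⌊dq n/2⌋−1} + (|H|+1)n²(1/9)^{⌊dq n/2⌋−⌊dq n/4⌋}) + 160Gn⁶e^{−a dq n} + 60Gn⁴√P_{dq n−4})·r`.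
READING: the one-block amplitude class is now priced for `|H| ≲ n^{5/8}/10` (bricks 154/156, type-constant part effective) and for `2|H| = n`
(brick 146); the gap `n^{5/8} ≲ |H| < n/2`, `|H| ≠ n/2` remains (eng MEMO-26 §5: Lq constants for intermediate blocks; 126/143/144 with `a ≠ d` for
unbalanced large blocks). WHAT THIS FILE DOES NOT DO: that gap; several blocks; anything on `TracialDecayExp20` itself, psd rank of
P_PM(K_n), or P vs NP. [cite: Rothvoss2017, §2 (PDF pp. 5–6)] [cite: GriblingDelaatLaurent2019, §5]
Stature: support/instrument (kernel lane, no defs, axioms standard); asymptotic in `a` (the `r = 1` rung). Supports stmt-PneNP-19878.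
-/

set_option linter.dupNamespace false -- `Summit.PneNP.PneNP.…`: summit = sub-problem (D-0017)

noncomputable section

namespace Summit.PneNP.PneNP.Theorems.ChebyshevTracialDesignTiltedSmallBlockAmplitudeOneCutoff

open Finset Matrix Literature.Barriers.PneNP Literature.Combinatorics.Optimization
open Summit.PneNP.PneNP.Theorems.ChebyshevTracialDesignColourSymmetricAmplitudeOne (colourSymmetric_amplitudeOne_of_typeConstant)
open Summit.PneNP.PneNP.Theorems.ChebyshevTracialDesignTiltedSmallBlockAverage (tilted_designValue_avg_le_cutoff_pow)
open Summit.PneNP.PneNP.Theorems.ChebyshevTracialDesignTiltedSmallBlockAmplitudeOne (card_map_inter_eq dq_facts)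
open Summit.PneNP.PneNP.Theorems.ChebyshevTracialDesignTiltedSmallBlockAllDirections (typeConstant_of_colour)

variable {n : ℕ}

/-! ### §1 Admissible parameters for blocks of size `≲ √(n·dq n)` -/

set_option maxHeartbeats 400000 in
/-- **Admissible parameters up to `|H| ≲ √(n·dq n)/10`.** For a balanced exact design at the Chebyshev parameters (`t = 2s₀+1`, `n ≤ 4t`,
`2t+2 ≤ n`), `100·h(h+1) ≤ n·dq n` and `12100 ≤ ⌊√n⌋`, the choice `R = s₀ − (3(dq n+1) + h + (Tq n−1)/2 + 2)` and the cut-off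
`a₁ = ⌊dq n/4⌋` satisfy the hypotheses of brick 153's `tilted_designValue_avg_le_cutoff_pow`. [cite: CoppersmithRivlin1992, Thm. (p. 970)] -/
theorem sqrtD_block_admissible {t s₀ h : ℕ} (ht : t = 2 * s₀ + 1) (hn4 : n ≤ 4 * t) (h2t : 2 * t + 2 ≤ n)
    (hh : 100 * (h * (h + 1)) ≤ n * dq n) (hm : 12100 ≤ Nat.sqrt n) :
    9 * (h * (h + 1)) ≤ (2 * (dq n / 4) + 1) * (n - 2 * h + 2 * (dq n / 4) + 1) ∧ 2 * h ≤ n ∧ dq n / 4 ≤ dq n / 2 ∧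
    1 ≤ s₀ - (3 * (dq n + 1) + h + (Tq n - 1) / 2 + 2) ∧
    s₀ - (3 * (dq n + 1) + h + (Tq n - 1) / 2 + 2) + 3 * (dq n + 1) + h + (Tq n - 1) / 2 ≤ s₀ ∧
    s₀ - (3 * (dq n + 1) + h + (Tq n - 1) / 2 + 2) + 3 * (dq n + 1) + h + s₀ + (Tq n - 1) / 2 + 2 ≤ n / 2 ∧
    ((h : ℝ) / ((s₀ - (3 * (dq n + 1) + h + (Tq n - 1) / 2 + 2) : ℕ) : ℝ)) ^ 2 *
        Real.exp (3 * h / ((s₀ - (3 * (dq n + 1) + h + (Tq n - 1) / 2 + 2) : ℕ) : ℝ)) ≤ 2 ∧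
    ((((Tq n - 1) / 2 : ℕ)) : ℝ) * ((1 / 4 : ℝ) * ((h : ℝ) / ((s₀ - (3 * (dq n + 1) + h + (Tq n - 1) / 2 + 2) : ℕ) : ℝ)) ^ 2 *
        Real.exp (3 * h / ((s₀ - (3 * (dq n + 1) + h + (Tq n - 1) / 2 + 2) : ℕ) : ℝ))) ≤ 1 / 9 := by
  set m := Nat.sqrt n with hmdef
  set D := dq n with hDdef
  have hmn : m * m ≤ n := Nat.sqrt_le n
  have hnm : n < (m + 1) * (m + 1) := Nat.lt_succ_sqrt n
  have hDm : D * D ≤ m := by rw [hDdef, dq]; exact Nat.sqrt_le m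
  have hD1 : 1 ≤ D := by rw [hDdef, dq, Nat.le_sqrt, Nat.le_sqrt]; omega
  have hDle : D ≤ m := le_trans (Nat.le_mul_of_pos_left D hD1) hDm
  have h110 : 110 * D ≤ m := by
    have e : (110 * D) * (110 * D) ≤ m * m :=
      calc (110 * D) * (110 * D) = 12100 * (D * D) := by ring
        _ ≤ 12100 * m := Nat.mul_le_mul_left _ hDm
        _ ≤ m * m := Nat.mul_le_mul_right m (by omega)
    exact Nat.mul_self_le_mul_self_iff.1 e
  have hT : (Tq n - 1) / 2 = 2 * m + 1 := by rw [Tq]; omega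
  -- sizes: `n ≤ m² + 2m`, `100h² ≤ (m²+2m)D ≤ 2m³`, hence `48h ≤ m²`
  have hn2 : n ≤ m * m + 2 * m := by
    have : (m + 1) * (m + 1) = m * m + 2 * m + 1 := by ring
    omega
  have hh2 : 100 * (h * h) ≤ (m * m + 2 * m) * D :=
    le_trans (Nat.mul_le_mul_left _ (Nat.mul_le_mul_left h (Nat.le_succ h))) (le_trans hh (Nat.mul_le_mul_right _ hn2))
  have h2m : 2 * m ≤ m * m := Nat.mul_le_mul_right m (by omega)
  have e1 : 10400 * (h * h) ≤ 2 * (m * m * m) :=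
    calc 10400 * (h * h) = 104 * (100 * (h * h)) := by ring
      _ ≤ 104 * ((m * m + 2 * m) * D) := Nat.mul_le_mul_left _ hh2
      _ = (m * m + 2 * m) * (104 * D) := by ring
      _ ≤ (m * m + m * m) * m := Nat.mul_le_mul (Nat.add_le_add_left h2m _) (by omega)
      _ = 2 * (m * m * m) := by ring
  have h48 : 48 * h ≤ m * m := by
    have e2 : (48 * h) * (48 * h) ≤ (m * m) * (m * m) :=
      calc (48 * h) * (48 * h) = 2304 * (h * h) := by ring
        _ ≤ 10400 * (h * h) := Nat.mul_le_mul_right _ (by norm_num)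
        _ ≤ 2 * (m * m * m) := e1
        _ ≤ m * (m * m * m) := Nat.mul_le_mul_right _ (by omega)
        _ = (m * m) * (m * m) := by ring
    exact Nat.mul_self_le_mul_self_iff.1 e2
  set K := 3 * (D + 1) + h + (Tq n - 1) / 2 + 2 with hKdef
  have hK : 48 * K ≤ m * m + 48 * (5 * m + 6) := by rw [hKdef, hT]; omega
  have hs₀ : m * m ≤ 8 * s₀ + 4 := by omega
  set R := s₀ - K with hRdef
  have hmm : 12100 * m ≤ m * m := Nat.mul_le_mul_right m hm
  have hR16 : m * m ≤ 16 * R := by omega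
  have hR1 : 1 ≤ R := by omega
  have h3h : 3 * h ≤ R := by omega
  refine ⟨?_, by omega, by omega, hR1, by omega, by omega, ?_, ?_⟩
  · -- `72 h(h+1) ≤ 100 h(h+1) ≤ nD ≤ 8·(2a₁+1)(n−2h+2a₁+1)`
    have h1 : D ≤ 4 * (2 * (D / 4) + 1) := by omega
    have h2 : n ≤ 2 * (n - 2 * h + 2 * (D / 4) + 1) := by omega
    have h3 : n * D ≤ 8 * ((2 * (D / 4) + 1) * (n - 2 * h + 2 * (D / 4) + 1)) := by
      calc n * D ≤ (2 * (n - 2 * h + 2 * (D / 4) + 1)) * (4 * (2 * (D / 4) + 1)) := Nat.mul_le_mul h2 h1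
        _ = 8 * ((2 * (D / 4) + 1) * (n - 2 * h + 2 * (D / 4) + 1)) := by ring
    omega
  all_goals
    have hRr : (1 : ℝ) ≤ R := by exact_mod_cast hR1
    have hRpos : (0 : ℝ) < R := by linarith
    have hmr : (12100 : ℝ) ≤ m := by exact_mod_cast hm
    have hmpos : (0 : ℝ) < m := by linarith
    have hD0 : (0 : ℝ) ≤ D := Nat.cast_nonneg D
    have h3h' : 3 * (h : ℝ) ≤ R := by exact_mod_cast h3h
    have hR16' : (m : ℝ) * m ≤ 16 * R := by exact_mod_cast hR16
    have hh2' : 100 * ((h : ℝ) * h) ≤ ((m : ℝ) * m + 2 * m) * D := by exact_mod_cast hh2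
    have h2m' : 2 * (m : ℝ) ≤ m * m := by exact_mod_cast h2m
    have h110' : 110 * (D : ℝ) ≤ m := by exact_mod_cast h110
    have hexp : Real.exp (3 * (h : ℝ) / R) ≤ 3 := by
      have h1 : 3 * (h : ℝ) / R ≤ 1 := by rw [div_le_one hRpos]; exact h3h'
      exact (Real.exp_le_exp.2 h1).trans (Real.exp_one_lt_d9.le.trans (by norm_num))
    have h4 : (h : ℝ) * h ≤ 3 * ((m : ℝ) * m) * D / 100 := by
      rw [le_div_iff₀ (by norm_num : (0:ℝ) < 100)]
      have : ((m : ℝ) * m + 2 * m) * D ≤ 3 * ((m : ℝ) * m) * D := by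
        have : ((m : ℝ) * m + 2 * m) ≤ 3 * ((m : ℝ) * m) := by linarith
        exact mul_le_mul_of_nonneg_right this hD0
      linarith
    have hm4 : ((m : ℝ) * m) * ((m : ℝ) * m) ≤ (16 * R) * (16 * R) := mul_le_mul hR16' hR16' (by positivity) (by positivity)
    -- `(h/R)² ≤ 8 D / m²`
    have hq : ((h : ℝ) / R) ^ 2 ≤ 8 * (D : ℝ) / (m : ℝ) ^ 2 := by
      rw [div_pow, div_le_div_iff₀ (by positivity) (by positivity)]
      have hDR : 0 ≤ (D : ℝ) * (R : ℝ) ^ 2 := by positivity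
      calc (h : ℝ) ^ 2 * (m : ℝ) ^ 2 = ((h : ℝ) * h) * ((m : ℝ) * m) := by ring
        _ ≤ (3 * ((m : ℝ) * m) * D / 100) * ((m : ℝ) * m) := mul_le_mul_of_nonneg_right h4 (by positivity)
        _ = 3 * D / 100 * (((m : ℝ) * m) * ((m : ℝ) * m)) := by ring
        _ ≤ 3 * D / 100 * ((16 * R) * (16 * R)) := mul_le_mul_of_nonneg_left hm4 (by positivity)
        _ = (768 / 100) * ((D : ℝ) * (R : ℝ) ^ 2) := by ring
        _ ≤ 8 * ((D : ℝ) * (R : ℝ) ^ 2) := by linarith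
        _ = 8 * (D : ℝ) * (R : ℝ) ^ 2 := by ring
    have hqe : ((h : ℝ) / R) ^ 2 * Real.exp (3 * (h : ℝ) / R) ≤ 24 * (D : ℝ) / (m : ℝ) ^ 2 :=
      calc _ ≤ 8 * (D : ℝ) / (m : ℝ) ^ 2 * 3 := mul_le_mul hq hexp (Real.exp_nonneg _) (by positivity)
        _ = 24 * (D : ℝ) / (m : ℝ) ^ 2 := by ring
    have hDm' : (D : ℝ) * m ≤ (m : ℝ) * m / 110 := by
      rw [le_div_iff₀ (by norm_num : (0:ℝ) < 110)]
      have := mul_le_mul_of_nonneg_right h110' hmpos.le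
      linarith
    have hsq : (m : ℝ) ^ 2 = m * m := sq _
  · calc _ ≤ 24 * (D : ℝ) / (m : ℝ) ^ 2 := hqe
      _ ≤ 2 := by
          rw [div_le_iff₀ (by positivity), hsq]
          linarith
  · rw [hT]
    push_cast
    have h27 : 27 * (m : ℝ) ≤ m * m := by nlinarith
    calc (2 * (m : ℝ) + 1) * (1 / 4 * ((h : ℝ) / R) ^ 2 * Real.exp (3 * (h : ℝ) / R))
        = (2 * (m : ℝ) + 1) * (1 / 4 * (((h : ℝ) / R) ^ 2 * Real.exp (3 * (h : ℝ) / R))) := by ring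
      _ ≤ (2 * (m : ℝ) + 1) * (1 / 4 * (24 * (D : ℝ) / (m : ℝ) ^ 2)) :=
          mul_le_mul_of_nonneg_left (mul_le_mul_of_nonneg_left hqe (by norm_num)) (by positivity)
      _ = (12 * ((D : ℝ) * m) + 6 * D) / (m : ℝ) ^ 2 := by field_simp; ring
      _ ≤ 1 / 9 := by
          rw [div_le_iff₀ (by positivity), hsq]
          have hD' : (D : ℝ) ≤ m / 110 := by linarith
          linarith

/-! ### §2 The 𝒜₁ rung up to `|H| ≲ √(n·dq n)` -/

/-- **THE 𝒜₁ RUNG FOR ONE-BLOCK MASKS ON BLOCKS WITH `100|H|(|H|+1) ≤ n·dq n` (brick 156).** There are `a > 0` and `n₀` such that for all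
even `n ≥ n₀`, every balanced `B = 20` Chebyshev design `(t, C, w)`, every block `H` with `100|H|(|H|+1) ≤ n·dq n`, every mask
`0 ≤ ψ ≤ G` on `[0,t]`, every degree-one Gram contraction `B_U = Σ_p x_p(U)β_p` with `B_UB_Uᵀ ⪯ I` on the `t`-cuts and every psd contraction
field `0 ⪯ Y_M ⪯ I` of dimension `r`:
`Σ_{U,M} W(U,M)·ψ(|U∩H|)·tr(B_UB_UᵀY_M) ≤ 8·(20G((5t+5Tq n+4)²(1/3)^{⌊dq n/2⌋−1} + (|H|+1)n²(1/9)^{⌊dq n/2⌋−⌊dq n/4⌋}) + 160Gn⁶e^{−a·dq n} + 60Gn⁴√P_{dq n−4})·r`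
(brick 150b with the colouring `𝟙_{H̄}` and `Btc` := brick 153 `tilted_designValue_avg_le_cutoff_pow` at `a₁ = ⌊dq n/4⌋`).
[cite: Rothvoss2017, §2 (PDF pp. 5–6)] [cite: GriblingDelaatLaurent2019, §5] -/
theorem mediumBlock_amplitudeOne_value_le :
    ∃ a : ℝ, 0 < a ∧ ∃ n₀ : ℕ, ∀ n : ℕ, n₀ ≤ n → Even n → ∀ {t : ℕ} {C : Finset ℕ} {w : ℕ → ℝ},
    IsBalancedDesign n t (Tq n) (dq n) 20 C w →
    ∀ (H : Finset (Fin n)), 100 * (H.card * (H.card + 1)) ≤ n * dq n →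
    ∀ (ψ : ℤ → ℝ) {G : ℝ}, 0 ≤ G → (∀ x ∈ Icc (0 : ℤ) (t : ℤ), |ψ x| ≤ G) → (∀ x ∈ Icc (0 : ℤ) (t : ℤ), 0 ≤ ψ x) →
    ∀ {r m : ℕ} (β : Fin n → Matrix (Fin r) (Fin m) ℝ),
    (∀ U : OddSet n, U.1.card = t →
      (1 - (∑ p, (if p ∈ U.1 then (1 : ℝ) else 0) • β p) * (∑ p, (if p ∈ U.1 then (1 : ℝ) else 0) • β p)ᵀ).PosSemidef) →
    ∀ (Y : PMatch n → Matrix (Fin r) (Fin r) ℝ), (∀ M, (Y M).PosSemidef ∧ (1 - Y M).PosSemidef) →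
    ∑ U : OddSet n, ∑ M : PMatch n, levelWeight n t C w U M *
        (ψ ((U.1 ∩ H).card : ℤ) *
          ((∑ p, (if p ∈ U.1 then (1 : ℝ) else 0) • β p) * (∑ p, (if p ∈ U.1 then (1 : ℝ) else 0) • β p)ᵀ * Y M).trace) ≤
      8 * (20 * G * ((5 * (t : ℝ) + 5 * (Tq n) + 4) ^ 2 * (1 / 3 : ℝ) ^ (dq n / 2 - 1) +
          ((H.card : ℝ) + 1) * (n : ℝ) ^ 2 * (1 / 9 : ℝ) ^ (dq n / 2 - dq n / 4)) +
        160 * G * (n : ℝ) ^ 6 * Real.exp (-(a * dq n)) +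
        60 * G * (n : ℝ) ^ 4 * Real.sqrt (∏ i ∈ range ((dq n - 4) / 2 + 1), ((2 * i + 1 : ℝ) / ((n : ℝ) - 2 * i)))) * r := by
  classical
  obtain ⟨a, ha, n₀, h150⟩ := colourSymmetric_amplitudeOne_of_typeConstant
  refine ⟨a, ha, max n₀ (12100 * 12100), ?_⟩
  intro n hn heven t C w hbal H hh ψ G hG0 hG hψ0 r m β hβ Y hY
  have hn₀ : n₀ ≤ n := le_trans (le_max_left _ _) hn
  have hm : 12100 ≤ Nat.sqrt n := by rw [Nat.le_sqrt]; exact le_trans (le_max_right _ _) hn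
  have h256 : 256 ≤ n := le_trans (by norm_num) (le_trans (le_max_right _ _) hn)
  obtain ⟨hD4, hDT⟩ := dq_facts h256
  have hdes : IsExactDesign n t (Tq n) (dq n) 20 C w := hbal.1
  have hN : (univ : Finset (Fin n)).card = 2 * (n / 2) := by
    rw [card_univ, Fintype.card_fin]; obtain ⟨k, hk⟩ := heven; omega
  have hn4 : n ≤ 4 * t := hbal.2
  have h2t : 2 * t + 2 ≤ n := hbal.1.2.1
  obtain ⟨s₀, hs₀⟩ := hbal.1.1
  obtain ⟨h9, h2h, ha₁, hR1, hRa, hRb, hq, hθ⟩ := sqrtD_block_admissible (n := n) (h := H.card) hs₀ hn4 h2t hh hm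
  have hht : H.card ≤ t := by omega
  -- the colouring and the mask
  set col : Fin n → Fin 2 := fun p => if p ∈ H then 0 else 1 with hcol
  have hc0 : ∀ p, p ∈ H → col p = 0 := fun p hp => by rw [hcol]; simp [hp]
  have hc1 : ∀ p, p ∉ H → col p = 1 := fun p hp => by rw [hcol]; simp [hp]
  have hcolH : ∀ p, col p = 0 ↔ p ∈ H := fun p => by
    by_cases hp : p ∈ H
    · simp [hc0 p hp, hp]
    · simp [hc1 p hp, hp]
  set f : Finset (Fin n) → ℝ := fun U => ψ ((U ∩ H).card : ℤ) with hf
  have hUH : ∀ U : Finset (Fin n), ((U ∩ H).card : ℤ) ∈ Icc (0 : ℤ) (t : ℤ) := by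
    intro U
    rw [mem_Icc]; refine ⟨by positivity, ?_⟩
    have := card_le_card (inter_subset_right (s₁ := U) (s₂ := H))
    exact_mod_cast this.trans hht
  have hf0 : ∀ U, 0 ≤ f U := fun U => hψ0 _ (hUH U)
  have hfG : ∀ U, f U ≤ G := fun U => (le_abs_self _).trans (hG _ (hUH U))
  have hfinv : ∀ (M : PMatch n) (g : Equiv.Perm (Fin n)), (∀ i, g (M.2.partner i) = M.2.partner (g i)) →
      (∀ i, col (g i) = col i) → ∀ U : Finset (Fin n), f (U.map g.toEmbedding) = f U := by
    intro M g _ hg U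
    rw [hf]
    simp only
    rw [card_map_inter_eq H U g (fun i => by rw [← hcolH, ← hcolH, hg i])]
  have hBtc : ∀ v : PMatch n → Fin n → ℝ, (∀ M p, |v M p| ≤ 1) →
      (∀ M p p', s(col p, col (M.2.partner p)) = s(col p', col (M.2.partner p')) → v M p = v M p') →
      ∑ M : PMatch n, ∑ U : OddSet n, levelWeight n t C w U M * (f U.1 *
        (∑ p : Fin n, v M p * ((if p ∈ U.1 then (1 : ℝ) else 0) * (if M.2.partner p ∈ U.1 then (1 : ℝ) else 0))) ^ 2) ≤
      20 * G * ((5 * (t : ℝ) + 5 * (Tq n) + 4) ^ 2 * (1 / 3 : ℝ) ^ (dq n / 2 - 1) +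
          ((H.card : ℝ) + 1) * (n : ℝ) ^ 2 * (1 / 9 : ℝ) ^ (dq n / 2 - dq n / 4)) := by
    intro v hv hvt
    have htc : ∀ M : PMatch n, _ := fun M => typeConstant_of_colour H M.2.partner col hc0 hc1 (v M) (hvt M)
    have h153 := tilted_designValue_avg_le_cutoff_pow hdes hN H rfl h9 h2h hs₀ hD4 hDT ha₁ hR1 hRa hRb hq hθ ψ hG0 hG hψ0
      v hv (fun M => (htc M).1) (fun M => (htc M).2.1) (fun M => (htc M).2.2)
    simpa only [hf] using h153
  have h := h150 n hn₀ heven hbal col f hG0 hf0 hfG hfinv hBtc β hβ Y hY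
  simpa only [hf] using h

end Summit.PneNP.PneNP.Theorems.ChebyshevTracialDesignTiltedSmallBlockAmplitudeOneCutoff

end
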